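import Summits.AtomisticToContinuum.Crystallization.Theorems.OverbindingBudgetAffinePatternRigid
import Summits.AtomisticToContinuum.Crystallization.Theorems.ChargedEnergyGap.Negative.BlocksBound
import Literature.MathematicalPhysics.StatisticalMechanics.LennardJonesHcpBelowFcc
import Literature.MathematicalPhysics.StatisticalMechanics.HcpFccLatticeSumsLayers

/-!
# ★★★ Z2 `FarCoreExcess` from hcp LATTICE SUMS and the far-window table — the `HcpEnergyUpper` bridge discharged
# (decomp-a2c lens-4, generation 66, Deliverable E; critic row 1101 (iii) item (iii): `X°`, `u := e_hcp(X°)`, the `HcpEnergyUpper` bridge)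

Imports D2 `…PatternRigid` (`farCoreExcess_record_of_farWindowData'`), the tree's `ChargedEnergyGapNegative.bddBelow_energyPerParticle_lennardJones`
(item 0714: the periodic energies are bounded below, so `⨅` is a genuine infimum) and the Literature's hcp energy series / certified lattice sums
(`hcp_lennardJones_energyPerParticle`, `StackingSums.hcpInvPowSum`, `lj_scale_energy_attained`, `hcpTerm_summable`).  Restates nothing.  PROVED (0 sorry):
* §H1 `hcpEnergyUpper_of_periodic` (every periodic `Q`: `e⋆ ≤ e(Q)`), `hcpEnergyUpper_hcp`, `hcpEnergyUpper_latticeSums`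
  (`e⋆ ≤ ½((1/12)a⁻¹²L₁₂(c) − (1/6)a⁻⁶L₆(c))`), `hcpInvPowSum_pos` (`L_{2n}(c) > 0`, `n ≥ 2`, `c ≠ 0`), the scale-optimised reference value
  `hcpScaleOpt c = −L₆(c)²/(24L₁₂(c))` and ★ `hcpEnergyUpper_scaleOpt (hc : c ≠ 0) : HcpEnergyUpper (hcpScaleOpt c)` (the optimum over the scale is
  ATTAINED by an hcp crystal) — this is memo g65 §8 (I)'s `u := e_hcp(X°)` with the scale optimised EXACTLY, so `X°` is the single axial parameter `c`
  and NO gradient enclosure in the scale direction is owed; `hcpEnergyUpper_scaleOpt_ideal` (`c² = 2/3`).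
* §H2 `windowTwelveLo_nonneg`, `windowSixUp_nonneg`; ★★★ `farCoreExcess_of_hcpLatticeSums`: for ANY `c ≠ 0` with `24κ′L₁₂(c) ≤ L₆(c)²`
  (`κ′ = 1/(2·10⁷) + 10⁻⁹`), the HOMOGENEOUS table inequality `T₃↑(w,X)²·L₁₂(c) ≤ (L₆(c)² − 24κ′L₁₂(c))·T₆↓(w,X)` over the far windows at tolerance
  `1/2000 − τ` (`0 < τ ≤ 1/100`) gives `FarCoreExcess (1/25) (1/2000) (1/(2·10⁷))` — no energy value `u`, no `HcpEnergyUpper`, no `PatternRigid`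
  hypothesis left; ★★★ `farCoreExcess_of_hcpEnclosures`: the same with CONSTANTS `l₃ ≤ L₆(c)`, `L₁₂(c) ≤ L₆⁺` in place of the sums (monotone in
  both), i.e. the exact interface of the hands' table: two one-sided enclosures of the reference sums at one rational `c°²` + the window blocks.
* §H3 dictionary by name: the reference sums are the Literature's certified layer sums (`StackingSums.hcpInvPowSum_eq_tsum_layerSum`).
Accuracy owed (memo §5): census of record (FarSmoothSplit Z2 docstring): min far excess `9.17·10⁻⁸ = 1.83κ`, `κ′ = κ + m = 5.1·10⁻⁸`, so the binding
far windows have slack `≈ 4·10⁻⁸` in `−T₃↑²/(24T₆↓) − u`; allotting `10⁻⁸` of it to the reference (`|u| ≈ 0.7175`, `u′ − u ≈ |u|(2δ₃ + δ₆)`):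
`δ₃ = 1 − l₃/L₆(c°) ≤ 5·10⁻⁹` and `δ₆ = L₆⁺/L₁₂(c°) − 1 ≤ 5·10⁻⁹` (relative); any `c°` is SOUND (`u(c°)` is an upper bound whatever `c°` is), a
sub-optimal `c°` only eats slack: `u(c) − u(c_opt) ≈ ½u″(c − c_opt)²`, so `c°` within `3·10⁻⁶` (relative) of the relaxed ratio costs `≲ 2·10⁻¹⁰`.
-/

namespace Summit.AtomisticToContinuum.Crystallization.Theorems.OverbindingBudgetAffineFarSmoothSplit

open scoped BigOperators
open Literature.MathematicalPhysics.StatisticalMechanics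

local notation "E3" => EuclideanSpace ℝ (Fin 3)

/-! ## §H1 `HcpEnergyUpper` bridges: every periodic configuration, every hcp crystal, the scale-optimised hcp energy at axial ratio `c` -/

/-- Every periodic configuration bounds `e⋆` from above (the energies are bounded below, `ChargedEnergyGapNegative.bddBelow_energyPerParticle_lennardJones`,
so `⨅` is a genuine infimum). -/
theorem hcpEnergyUpper_of_periodic (Q : PeriodicConfiguration 3) : HcpEnergyUpper (Q.energyPerParticle lennardJones) :=
  ciInf_le ChargedEnergyGapNegative.bddBelow_energyPerParticle_lennardJones Q

/-- `HcpEnergyUpper.mono` (docstring added by the landing lane; see the module docstring). [formal bookkeeping] -/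
theorem HcpEnergyUpper.mono {u u' : ℝ} (h : HcpEnergyUpper u) (huu' : u ≤ u') : HcpEnergyUpper u' :=
  le_trans h huu'

/-- The hcp crystal `hcp(a, h)` (in-layer spacing `a`, layer height `h`) bounds `e⋆`: `e⋆ ≤ e(hcp(a,h))`. -/
theorem hcpEnergyUpper_hcp {a h : ℝ} (ha : a ≠ 0) (hh : h ≠ 0) :
    HcpEnergyUpper ((hcpPeriodicConfiguration ha hh).energyPerParticle lennardJones) :=
  hcpEnergyUpper_of_periodic _

/-- … through the hcp lattice sums `L₆ʰᶜᵖ(c) = StackingSums.hcpInvPowSum 3 c`, `L₁₂ʰᶜᵖ(c) = StackingSums.hcpInvPowSum 6 c` at axial parameter `c = h/a`: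
`e⋆ ≤ ½((1/12) a⁻¹² L₁₂(c) − (1/6) a⁻⁶ L₆(c))` for every scale `a ≠ 0`. -/
theorem hcpEnergyUpper_latticeSums {a c : ℝ} (ha : a ≠ 0) (hc : c ≠ 0) :
    HcpEnergyUpper (1 / 2 * (1 / 12 * (a⁻¹) ^ 12 * StackingSums.hcpInvPowSum 6 c - 1 / 6 * (a⁻¹) ^ 6 * StackingSums.hcpInvPowSum 3 c)) := by
  have h := hcpEnergyUpper_hcp ha (mul_ne_zero ha hc)
  rwa [hcp_lennardJones_energyPerParticle ha hc] at h

/-- The hcp lattice sums are POSITIVE for every axial parameter `c ≠ 0` (`n ≥ 2`: summable by `StackingSums.hcpTerm_summable`, every term `≥ 0`, the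
in-layer neighbour `(0, 1, 0)` contributes `1`). -/
theorem hcpInvPowSum_pos {n : ℕ} (hn : 2 ≤ n) {c : ℝ} (hc : c ≠ 0) : 0 < StackingSums.hcpInvPowSum n c := by
  have hnn : ∀ v, 0 ≤ StackingSums.hcpTerm n c v := fun v => by
    obtain ⟨k, i, j⟩ := v
    rw [StackingSums.hcpTerm_eq_layerTerm (by omega)]
    exact StackingSums.layerTerm_nonneg (StackingSums.pattern_le_one _) _ (by positivity) _
  have h1 : 0 < StackingSums.hcpTerm n c (0, 1, 0) := by
    norm_num [StackingSums.hcpTerm, StackingSums.hcpForm]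
  exact (StackingSums.hcpTerm_summable hn hc).tsum_pos hnn _ h1

/-- The SCALE-OPTIMISED hcp energy at axial parameter `c`: `u(c) = −L₆(c)²/(24 L₁₂(c))` (the minimum over the scale `a` of
`½((1/12)a⁻¹²L₁₂ − (1/6)a⁻⁶L₆)`, attained at `a⁶ = L₁₂/L₆`). This is the `u = e_hcp(X°)` of memo g65 §8 (I) with `X° = diag(a°, a°, ·)` encoded by the
single parameter `c` (the scale is optimised exactly). -/
noncomputable def hcpScaleOpt (c : ℝ) : ℝ := -(StackingSums.hcpInvPowSum 3 c ^ 2 / (24 * StackingSums.hcpInvPowSum 6 c))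

/-- ★ `e⋆ ≤ u(c) = −L₆(c)²/(24 L₁₂(c))` for every axial parameter `c ≠ 0` with positive lattice sums (the optimum over the scale is ATTAINED by an hcp
crystal, `StackingSums.lj_scale_energy_attained`; positivity of the sums from `hcpInvPowSum_pos`). -/
theorem hcpEnergyUpper_scaleOpt {c : ℝ} (hc : c ≠ 0) : HcpEnergyUpper (hcpScaleOpt c) := by
  obtain ⟨a, ha, he⟩ := StackingSums.lj_scale_energy_attained (hcpInvPowSum_pos (n := 3) (by norm_num) hc) (hcpInvPowSum_pos (n := 6) (by norm_num) hc)
  have h := hcpEnergyUpper_latticeSums ha.ne' hc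
  rwa [he] at h

/-- In particular at the ideal ratio `c² = 2/3`: `e⋆ ≤ −(L₆ʰᶜᵖ)²/(24 L₁₂ʰᶜᵖ)` (the Literature's certified `e*_hcp`). -/
theorem hcpEnergyUpper_scaleOpt_ideal : HcpEnergyUpper (hcpScaleOpt (Real.sqrt (2 / 3))) :=
  hcpEnergyUpper_scaleOpt Literature.MathematicalPhysics.StatisticalMechanics.sqrt_two_thirds_ne_zero

/-! ## §H2 The Z2 record in LATTICE-SUM form: no energy value `u` left — one homogeneous inequality between window sums and hcp sums -/

/-- `windowTwelveLo_nonneg` (docstring added by the landing lane; see the module docstring). [formal bookkeeping] -/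
theorem windowTwelveLo_nonneg (w : Fin 6 → ℤ) (B : E3 →ₗ[ℝ] E3) : 0 ≤ windowTwelveLo w B :=
  tsum_nonneg fun k => layerLo_nonneg w B 12 k

/-- `windowSixUp_nonneg` (docstring added by the landing lane; see the module docstring). [formal bookkeeping] -/
theorem windowSixUp_nonneg (w : Fin 6 → ℤ) (B : E3 →ₗ[ℝ] E3) : 0 ≤ windowSixUp w B :=
  tsum_nonneg fun k => layerUp_nonneg w B 6 k

/-- ★★★ **Z2 from hcp lattice sums and the far-window table.**  Fix ANY axial parameter `c ≠ 0` (the hands' `c°`, e.g. `c°² ∈ ℚ` near the relaxed hcp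
ratio) with `24κ′L₁₂(c) ≤ L₆(c)²` (`κ′ = 1/(2·10⁷) + 10⁻⁹`; numerically `1.5·10⁻⁵ ≤ 209`).  If every far window `(w, X)` at
tolerance `1/2000 − τ` (`0 < τ ≤ 1/100`) satisfies the HOMOGENEOUS inequality
`T₃↑(w,X)² · L₁₂(c) ≤ (L₆(c)² − 24κ′L₁₂(c)) · T₆↓(w,X)`, then `FarCoreExcess (1/25) (1/2000) (1/(2·10⁷))`.
(`u := u(c)`, `HcpEnergyUpper u` by §H1, `u + κ′ ≤ 0` from `hκ`, and the record's `hcert` after division by `L₁₂(c) > 0`.) -/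
theorem farCoreExcess_of_hcpLatticeSums {c τ : ℝ} (hc : c ≠ 0) (hτ : 0 < τ) (hτ' : τ ≤ 1 / 100)
    (hκ : 24 * (1 / (2 * 10 ^ 7) + 1 / 10 ^ 9) * StackingSums.hcpInvPowSum 6 c ≤ StackingSums.hcpInvPowSum 3 c ^ 2)
    (hcert : ∀ (w : Fin 6 → ℤ) (X : E3 →ₗ[ℝ] E3), FarWindowData (1 / 25) (1 / 2000 - τ) w X →
      windowSixUp w X ^ 2 * StackingSums.hcpInvPowSum 6 c ≤ (StackingSums.hcpInvPowSum 3 c ^ 2 - 24 * (1 / (2 * 10 ^ 7) + 1 / 10 ^ 9) * StackingSums.hcpInvPowSum 6 c) * windowTwelveLo w X) :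
    FarCoreExcess (1 / 25) (1 / 2000) (1 / (2 * 10 ^ 7)) := by
  have h6 : 0 < StackingSums.hcpInvPowSum 6 c := hcpInvPowSum_pos (by norm_num) hc
  have hu : hcpScaleOpt c + 1 / (2 * 10 ^ 7) + 1 / 10 ^ 9 ≤ 0 := by
    have : 1 / (2 * 10 ^ 7) + 1 / 10 ^ 9 ≤ StackingSums.hcpInvPowSum 3 c ^ 2 / (24 * StackingSums.hcpInvPowSum 6 c) := by
      rw [le_div_iff₀ (by positivity)]; linarith
    unfold hcpScaleOpt; linarith
  refine farCoreExcess_record_of_farWindowData' hτ hτ' (hcpEnergyUpper_scaleOpt hc) hu fun w X hX => ?_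
  have key : 24 * (-(hcpScaleOpt c + 1 / (2 * 10 ^ 7) + 1 / 10 ^ 9)) =
      (StackingSums.hcpInvPowSum 3 c ^ 2 - 24 * (1 / (2 * 10 ^ 7) + 1 / 10 ^ 9) * StackingSums.hcpInvPowSum 6 c) / StackingSums.hcpInvPowSum 6 c := by
    unfold hcpScaleOpt; field_simp; ring
  rw [key, div_mul_eq_mul_div, le_div_iff₀ h6]
  exact hcert w X hX

/-- ★★★ **… in ENCLOSURE form** (the exact interface of the table): rational (or any real) bounds `l₃ ≤ L₆(c)` (`0 < l₃`), `L₁₂(c) ≤ L₆⁺` and the table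
inequality with the CONSTANTS `l₃, L₆⁺` in place of the sums, `T₃↑² · L₆⁺ ≤ (l₃² − 24κ′L₆⁺) · T₆↓` for every far window, give Z2 (monotonicity:
`T₆↓ ≥ 0`, `T₃↑² ≥ 0`).  Accuracy owed by the enclosures: the binding far windows have slack of order `10⁻⁸` in `−T₃↑²/(24T₆↓) − u`, so `l₃` must be
within relative `≈ 5·10⁻¹⁰` of `L₆(c°)` and `L₆⁺` within `≈ 10⁻⁹` of `L₁₂(c°)` (memo §E). -/
theorem farCoreExcess_of_hcpEnclosures {c τ l3 L6hi : ℝ} (hc : c ≠ 0) (hτ : 0 < τ) (hτ' : τ ≤ 1 / 100) (hl3 : 0 < l3)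
    (hL3 : l3 ≤ StackingSums.hcpInvPowSum 3 c) (hL6 : StackingSums.hcpInvPowSum 6 c ≤ L6hi)
    (hκ : 24 * (1 / (2 * 10 ^ 7) + 1 / 10 ^ 9) * L6hi ≤ l3 ^ 2)
    (hcert : ∀ (w : Fin 6 → ℤ) (X : E3 →ₗ[ℝ] E3), FarWindowData (1 / 25) (1 / 2000 - τ) w X →
      windowSixUp w X ^ 2 * L6hi ≤ (l3 ^ 2 - 24 * (1 / (2 * 10 ^ 7) + 1 / 10 ^ 9) * L6hi) * windowTwelveLo w X) :
    FarCoreExcess (1 / 25) (1 / 2000) (1 / (2 * 10 ^ 7)) := by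
  have h6 : 0 < StackingSums.hcpInvPowSum 6 c := hcpInvPowSum_pos (by norm_num) hc
  have hsq : l3 ^ 2 ≤ StackingSums.hcpInvPowSum 3 c ^ 2 := pow_le_pow_left₀ hl3.le hL3 2
  refine farCoreExcess_of_hcpLatticeSums hc hτ hτ' (by nlinarith) fun w X hX => ?_
  have hT := windowTwelveLo_nonneg w X
  have hS := sq_nonneg (windowSixUp w X)
  have h1 : windowSixUp w X ^ 2 * StackingSums.hcpInvPowSum 6 c ≤ windowSixUp w X ^ 2 * L6hi := mul_le_mul_of_nonneg_left hL6 hS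
  have h2 : (l3 ^ 2 - 24 * (1 / (2 * 10 ^ 7) + 1 / 10 ^ 9) * L6hi) * windowTwelveLo w X ≤
      (StackingSums.hcpInvPowSum 3 c ^ 2 - 24 * (1 / (2 * 10 ^ 7) + 1 / 10 ^ 9) * StackingSums.hcpInvPowSum 6 c) * windowTwelveLo w X :=
    mul_le_mul_of_nonneg_right (by nlinarith) hT
  exact h1.trans ((hcert w X hX).trans h2)

/-! ## §H3 Dictionary (by name, nothing restated).  The reference sums ARE layer sums of the Literature's certified kernel:
`StackingSums.hcpInvPowSum_eq_tsum_layerSum : hcpInvPowSum n c = Σ'_k StackingSums.layerSum [k odd] n (k²c²)` (`n ≥ 2`, `c ≠ 0`;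
`…HcpFccLatticeSumsLayers`), each layer the two-dimensional kernel of `…HcpFccLatticeSumsKernel*` / `…Eval` with the tail bounds of `…Tail`; the
enclosures `l₃ ≤ L₆(c°)`, `L₁₂(c°) ≤ L₆⁺` of `farCoreExcess_of_hcpEnclosures` are produced by that kernel at the hands' rational `c°²`. -/

end Summit.AtomisticToContinuum.Crystallization.Theorems.OverbindingBudgetAffineFarSmoothSplit
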